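import Literature.MathematicalPhysics.QuantumFieldTheory.Balaban1983to89.Beta.HomogSmooth
import Literature.MathematicalPhysics.QuantumFieldTheory.Balaban1983to89.Beta.TransverseLink

/-!
# `Balaban1983to89.Beta.HomogSmoothTransverse` — the `HomogSmooth` constructor applied to the transverse-tensor objects of
`Beta.TransverseStructure` / `Beta.TransverseLink`: every candidate leading tensor field of item (vi) yields a `HomogKernel` /
`DyadicData` moment kernel with NO hand constants (β sub-cell, lead's bridge node BETA-LEAD-HOMOGSMOOTH-TRANSVERSE)

HONEST FRAMING (cell rule, verbatim): discharging `BetaPertH` makes Bałaban's UV stability UNCONDITIONAL — a real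
constructive-QFT result; it is NOT the continuum limit and NOT the Clay problem.  (Gloss, BETA-SPEC v1.8d/v1.9b
l. 17–18, GAPS G-ref2-14 (a) / G-ref2-20 (a), verbatim: «UNCONDITIONAL» in [Balaban1989LargeFieldII] (B16) p. 355's
interval-hypothesis sense ONLY (`FlowStepRuns.p355Unconditional_of_partialSums` keeps `hnodes`); the located leaves
G-adv3-2 (left inequality of (0.1)/(2.50), d = 4), G-adv3-1 (U2 transfer of B14 Cor. 3's lower bound) and `SecondExpLeaf`
REMAIN.  Gloss 2, BETA-SPEC v1.9e, beta-ref C-beta-78, BINDING: «unconditional» = `Beta.Assembly.EventualForm`-unconditional END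
statement, NOT «Theorem 2 as printed».)  THIS MODULE DISCHARGES NOTHING of the series and asserts nothing about Bałaban's
β-functions: it is degree bookkeeping (`HomogSmooth.IsHomog`) and Mathlib `ContDiff` closure for the explicit rational tensor
fields of `Beta.TransverseStructure` (lit1), composed BY NAME with `HomogSmooth.exists_homogKernel` (lead) and
`TransverseLink.fieldMomentKernel` (lit1).  Every declaration is `[folklore]`.  Value = kernel utility (audit cell `pub-balaban`,
β sub-cell, unit `b2b-balaban-strat-b12` gen 6; BETA-SPEC v1.9e §6.10/§7.11), NOT summit progress.

WHAT IS PROVED (0 sorry).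
* §1 degrees: `r2` (= `normSq`, degree 2), `invQuartic` (−4), `d1InvQuartic μ` (−5), `hessInvQuartic μ ν`, `lapInvQuartic`,
  `transverse μ ν`, `covFamily a b μ ν`, `localFamily a b c μ ν` (all −6); the entries of any `IsHomogNegSix` tensor field are
  `IsHomog (-6)` (`isHomog_entry_of_isHomogNegSix`).
* §2 smoothness off the origin (`HomogSmooth.punct = {0}ᶜ`): all of the above are `C¹` (indeed rational) on `punct`.
* §3 THE MOMENT KERNELS: for every `a b c μ ν`, `x ↦ x μ * x ν * covFamily a b μ ν x` and `x ↦ x μ * x ν * localFamily a b c μ ν x`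
  are `HomogKernel`s for SOME constants (`exists_homogKernel_covMoment`, `exists_homogKernel_localMoment`), and so is
  `x ↦ x μ * x ν * S x μ ν` for every tensor field `S` with `IsHomogNegSix S` whose entries are `C¹` off the origin
  (`exists_homogKernel_fieldMoment`); consequently `TransverseLink.fieldMomentKernel S μ ν` satisfies `DyadicShell.DyadicData`
  for some constant (`exists_dyadicData_fieldMomentKernel`) — the `data` slot of `LargeLWindow.WindowDecomposition` for the
  FIELD FORM of item (vi) (`TransverseLink.af0L_iff_of_field`), with no hand computation.  For O(4)-covariant `S` the entries'
  smoothness follows from `TransverseStructure.eq_covFamily_of_covariant` (`contDiffOn_entry_of_covariant`), so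
  `exists_dyadicData_fieldMomentKernel_of_covariant` needs only `IsO4Covariant S ∧ IsHomogNegSix S`.

NOT COVERED: explicit constants (use `LeadingCoefficient.homogKernel_transverseUnit` / `TransverseLink` when numerics need
them); anything about Bałaban's actual kernel.
-/

namespace Literature.MathematicalPhysics.QuantumFieldTheory.Balaban1983to89.Beta.HomogSmoothTransverse

open Literature.MathematicalPhysics.QuantumFieldTheory.Balaban1983to89.Beta.DyadicShell (HomogKernel DyadicData Pt toReal
  dyadicData_of_homogKernel)
open Literature.MathematicalPhysics.QuantumFieldTheory.Balaban1983to89.Beta.LeadingCoefficient (normSq)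
open Literature.MathematicalPhysics.QuantumFieldTheory.Balaban1983to89.Beta.TransverseStructure (E4 r2 r2_pos r2_smul invQuartic
  d1InvQuartic hessInvQuartic lapInvQuartic transverse covFamily localFamily TensorField IsO4Covariant IsHomogNegSix axisPt
  eq_covFamily_of_covariant)
open Literature.MathematicalPhysics.QuantumFieldTheory.Balaban1983to89.Beta.TransverseLink (fieldMomentKernel r2_eq_normSq)
open Literature.MathematicalPhysics.QuantumFieldTheory.Balaban1983to89.Beta.HomogSmooth (IsHomog punct mem_punct exists_homogKernel
  contDiff_coord contDiff_normSq exists_dyadicData)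

noncomputable section

variable {a b c : ℝ} {μ ν : Fin 4}

/-! ## 1. Degrees of the transverse-tensor objects -/

/-- `r2 = normSq` has degree `2`. [folklore] -/
theorem isHomog_r2 : IsHomog 2 r2 := by
  intro t _ x _
  rw [r2_smul]
  norm_cast

/-- `r2 ^ m` has degree `2m`. [folklore] -/
theorem isHomog_r2_pow (m : ℕ) : IsHomog (2 * m) (fun x : E4 => r2 x ^ m) :=
  (isHomog_r2.pow m).of_eq (by ring)

/-- `invQuartic = 1/r2²` has degree `−4`. [folklore] -/
theorem isHomog_invQuartic : IsHomog (-4) invQuartic := by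
  have h := (IsHomog.const (1 : ℝ)).div (isHomog_r2_pow 2)
  exact h.of_eq (by norm_num)

/-- `d1InvQuartic μ = −4x_μ/r2³` has degree `−5`. [folklore] -/
theorem isHomog_d1InvQuartic (μ : Fin 4) : IsHomog (-5) (d1InvQuartic μ) := by
  have h : IsHomog (-5) (fun x : E4 => -4 * x μ / r2 x ^ 3) :=
    (((IsHomog.coord μ).const_mul (-4)).div (isHomog_r2_pow 3)).of_eq (by norm_num)
  intro t ht x hx
  simpa only [d1InvQuartic] using h t ht x hx

/-- The diagonal Kronecker pieces `x ↦ if μ = ν then a / r2 x ^ m else 0` have degree `−2m`. [folklore] -/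
theorem isHomog_ite_div_r2_pow (a : ℝ) (μ ν : Fin 4) (m : ℕ) :
    IsHomog (-(2 * m)) (fun x : E4 => if μ = ν then a / r2 x ^ m else 0) := by
  by_cases h : μ = ν
  · simp only [h, if_true]
    exact ((IsHomog.const a).div (isHomog_r2_pow m)).of_eq (by ring)
  · simp only [h, if_false]
    intro t _ x _
    simp

/-- `hessInvQuartic μ ν = 24x_μx_ν/r2⁴ − δ_{μν}·4/r2³` has degree `−6`. [folklore] -/
theorem isHomog_hessInvQuartic (μ ν : Fin 4) : IsHomog (-6) (hessInvQuartic μ ν) := by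
  have h1 : IsHomog (-6) (fun x : E4 => 24 * x μ * x ν / r2 x ^ 4) := by
    have := ((((IsHomog.coord μ).const_mul 24).mul (IsHomog.coord ν)).div (isHomog_r2_pow 4))
    exact this.of_eq (by norm_num)
  have h2 : IsHomog (-6) (fun x : E4 => if μ = ν then (4 : ℝ) / r2 x ^ 3 else 0) :=
    (isHomog_ite_div_r2_pow 4 μ ν 3).of_eq (by norm_num)
  have h := h1.sub h2
  intro t ht x hx
  simpa only [hessInvQuartic] using h t ht x hx

/-- `lapInvQuartic = 8/r2³` has degree `−6`. [folklore] -/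
theorem isHomog_lapInvQuartic : IsHomog (-6) lapInvQuartic := by
  have h : IsHomog (-6) (fun x : E4 => 8 / r2 x ^ 3) :=
    ((IsHomog.const (8 : ℝ)).div (isHomog_r2_pow 3)).of_eq (by norm_num)
  intro t ht x hx
  simpa only [lapInvQuartic] using h t ht x hx

/-- The transverse structure `T_{μν} = (∂_μ∂_ν − δ_{μν}Δ)|x|⁻⁴` has degree `−6`. [folklore] -/
theorem isHomog_transverse (μ ν : Fin 4) : IsHomog (-6) (transverse μ ν) := by
  have h2 : IsHomog (-6) (fun x : E4 => if μ = ν then lapInvQuartic x else 0) := by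
    by_cases h : μ = ν
    · simp only [h, if_true]; exact isHomog_lapInvQuartic
    · simp only [h, if_false]; intro t _ x _; simp
  have h := (isHomog_hessInvQuartic μ ν).sub h2
  intro t ht x hx
  simpa only [transverse] using h t ht x hx

/-- The covariant family `S^{a,b}_{μν} = b·x_μx_ν/r2⁴ + a·δ_{μν}/r2³` has degree `−6`. [folklore] -/
theorem isHomog_covFamily (a b : ℝ) (μ ν : Fin 4) : IsHomog (-6) (covFamily a b μ ν) := by
  have h1 : IsHomog (-6) (fun x : E4 => b * x μ * x ν / r2 x ^ 4) := by
    have := ((((IsHomog.coord μ).const_mul b).mul (IsHomog.coord ν)).div (isHomog_r2_pow 4))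
    exact this.of_eq (by norm_num)
  have h2 : IsHomog (-6) (fun x : E4 => if μ = ν then a / r2 x ^ 3 else 0) :=
    (isHomog_ite_div_r2_pow a μ ν 3).of_eq (by norm_num)
  have h := h1.add h2
  intro t ht x hx
  simpa only [covFamily] using h t ht x hx

/-- The local hypercubic family `L^{a,b,c}_{μν}` has degree `−6`. [folklore] -/
theorem isHomog_localFamily (a b c : ℝ) (μ ν : Fin 4) : IsHomog (-6) (localFamily a b c μ ν) := by
  have h1 : IsHomog (-6) (fun x : E4 => b * hessInvQuartic μ ν x) := (isHomog_hessInvQuartic μ ν).const_mul b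
  have h2 : IsHomog (-6) (fun x : E4 => if μ = ν then a * lapInvQuartic x + c * hessInvQuartic μ μ x else 0) := by
    by_cases h : μ = ν
    · simp only [h, if_true]
      exact (isHomog_lapInvQuartic.const_mul a).add ((isHomog_hessInvQuartic ν ν).const_mul c)
    · simp only [h, if_false]; intro t _ x _; simp
  have h := h1.add h2
  intro t ht x hx
  simpa only [localFamily] using h t ht x hx

/-- The entries of a degree-`−6` tensor field (lit1's `IsHomogNegSix`, stated with `(t ^ 6)⁻¹ •`) are `IsHomog (-6)`.
[folklore] -/
theorem isHomog_entry_of_isHomogNegSix {S : TensorField} (hS : IsHomogNegSix S) (μ ν : Fin 4) :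
    IsHomog (-6) (fun x => S x μ ν) := by
  intro t ht x hx
  have h := hS t ht x hx
  have hentry : S (t • x) μ ν = (t ^ 6)⁻¹ * S x μ ν := by
    have := congrFun (congrFun h μ) ν
    simpa only [Matrix.smul_apply, smul_eq_mul] using this
  show S (t • x) μ ν = t ^ (-6 : ℤ) * S x μ ν
  rw [hentry, show (-6 : ℤ) = -((6 : ℕ) : ℤ) by norm_num, zpow_neg, zpow_natCast]

/-! ## 2. Smoothness off the origin -/

/-- `r2` is smooth (it is `normSq`). [folklore] -/
theorem contDiff_r2 {n : WithTop ℕ∞} : ContDiff ℝ n r2 := by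
  have h : r2 = normSq := funext r2_eq_normSq
  rw [h]; exact contDiff_normSq

/-- `r2` does not vanish off the origin. [folklore] -/
theorem r2_ne_zero_of_mem_punct {x : E4} (hx : x ∈ punct) : r2 x ≠ 0 := (r2_pos (mem_punct.mp hx)).ne'

/-- A quotient `P / r2 ^ m` with `P ∈ C¹(ℝ⁴)` is `C¹` off the origin. [folklore] -/
theorem contDiffOn_div_r2_pow {P : E4 → ℝ} (hP : ContDiff ℝ 1 P) (m : ℕ) :
    ContDiffOn ℝ 1 (fun x : E4 => P x / r2 x ^ m) punct :=
  hP.contDiffOn.div ((contDiff_r2.pow m).contDiffOn) fun _ hx => pow_ne_zero m (r2_ne_zero_of_mem_punct hx)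

/-- The diagonal Kronecker pieces are `C¹` off the origin. [folklore] -/
theorem contDiffOn_ite_div_r2_pow (a : ℝ) (μ ν : Fin 4) (m : ℕ) :
    ContDiffOn ℝ 1 (fun x : E4 => if μ = ν then a / r2 x ^ m else 0) punct := by
  by_cases h : μ = ν
  · simp only [h, if_true]; exact contDiffOn_div_r2_pow contDiff_const m
  · simp only [h, if_false]; exact contDiffOn_const

/-- `hessInvQuartic μ ν` is `C¹` off the origin. [folklore] -/
theorem contDiffOn_hessInvQuartic (μ ν : Fin 4) : ContDiffOn ℝ 1 (hessInvQuartic μ ν) punct := by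
  have h1 : ContDiffOn ℝ 1 (fun x : E4 => 24 * x μ * x ν / r2 x ^ 4) punct :=
    contDiffOn_div_r2_pow ((contDiff_const.mul (contDiff_coord μ)).mul (contDiff_coord ν)) 4
  have h := h1.sub (contDiffOn_ite_div_r2_pow 4 μ ν 3)
  exact h.congr fun x _ => by simp only [hessInvQuartic]

/-- `lapInvQuartic` is `C¹` off the origin. [folklore] -/
theorem contDiffOn_lapInvQuartic : ContDiffOn ℝ 1 lapInvQuartic punct :=
  (contDiffOn_div_r2_pow (contDiff_const (c := (8 : ℝ))) 3).congr fun x _ => by simp only [lapInvQuartic]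

/-- `transverse μ ν` is `C¹` off the origin. [folklore] -/
theorem contDiffOn_transverse (μ ν : Fin 4) : ContDiffOn ℝ 1 (transverse μ ν) punct := by
  have h2 : ContDiffOn ℝ 1 (fun x : E4 => if μ = ν then lapInvQuartic x else 0) punct := by
    by_cases h : μ = ν
    · simp only [h, if_true]; exact contDiffOn_lapInvQuartic
    · simp only [h, if_false]; exact contDiffOn_const
  exact ((contDiffOn_hessInvQuartic μ ν).sub h2).congr fun x _ => by simp only [transverse]

/-- `covFamily a b μ ν` is `C¹` off the origin. [folklore] -/
theorem contDiffOn_covFamily (a b : ℝ) (μ ν : Fin 4) : ContDiffOn ℝ 1 (covFamily a b μ ν) punct := by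
  have h1 : ContDiffOn ℝ 1 (fun x : E4 => b * x μ * x ν / r2 x ^ 4) punct :=
    contDiffOn_div_r2_pow ((contDiff_const.mul (contDiff_coord μ)).mul (contDiff_coord ν)) 4
  exact (h1.add (contDiffOn_ite_div_r2_pow a μ ν 3)).congr fun x _ => by simp only [covFamily]

/-- `localFamily a b c μ ν` is `C¹` off the origin. [folklore] -/
theorem contDiffOn_localFamily (a b c : ℝ) (μ ν : Fin 4) : ContDiffOn ℝ 1 (localFamily a b c μ ν) punct := by
  have h1 : ContDiffOn ℝ 1 (fun x : E4 => b * hessInvQuartic μ ν x) punct :=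
    contDiffOn_const.mul (contDiffOn_hessInvQuartic μ ν)
  have h2 : ContDiffOn ℝ 1 (fun x : E4 => if μ = ν then a * lapInvQuartic x + c * hessInvQuartic μ μ x else 0) punct := by
    by_cases h : μ = ν
    · simp only [h, if_true]
      exact (contDiffOn_const.mul contDiffOn_lapInvQuartic).add (contDiffOn_const.mul (contDiffOn_hessInvQuartic ν ν))
    · simp only [h, if_false]; exact contDiffOn_const
  exact (h1.add h2).congr fun x _ => by simp only [localFamily]

/-- For an O(4)-covariant degree-`−6` tensor field the entries are `C¹` off the origin (they agree with a `covFamily` there,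
`TransverseStructure.eq_covFamily_of_covariant`). [folklore] -/
theorem contDiffOn_entry_of_covariant {S : TensorField} (hS : IsO4Covariant S) (hH : IsHomogNegSix S) (μ ν : Fin 4) :
    ContDiffOn ℝ 1 (fun x => S x μ ν) punct :=
  (contDiffOn_covFamily (S (axisPt 1) 1 1) (S (axisPt 1) 0 0 - S (axisPt 1) 1 1) μ ν).congr fun _ hx =>
    eq_covFamily_of_covariant hS hH (mem_punct.mp hx) μ ν

/-! ## 3. The moment kernels are `HomogKernel`s; the `data` slot for the field form of item (vi) -/

/-- Generic: a degree-`−6` entry that is `C¹` off the origin gives a `HomogKernel` moment kernel `x_μ x_ν · S_{μν}(x)`.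
[folklore] -/
theorem exists_homogKernel_moment {F : E4 → ℝ} (hh : IsHomog (-6) F) (hF : ContDiffOn ℝ 1 F punct) (μ ν : Fin 4) :
    ∃ A Λ : ℝ, HomogKernel (fun x => x μ * x ν * F x) A Λ :=
  HomogSmooth.exists_homogKernel_fieldForm hh hF μ ν

/-- The covariant-family moment kernel is a `HomogKernel` for some constants. [folklore] -/
theorem exists_homogKernel_covMoment (a b : ℝ) (μ ν : Fin 4) :
    ∃ A Λ : ℝ, HomogKernel (fun x => x μ * x ν * covFamily a b μ ν x) A Λ :=
  exists_homogKernel_moment (isHomog_covFamily a b μ ν) (contDiffOn_covFamily a b μ ν) μ ν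

/-- The local-family moment kernel is a `HomogKernel` for some constants. [folklore] -/
theorem exists_homogKernel_localMoment (a b c : ℝ) (μ ν : Fin 4) :
    ∃ A Λ : ℝ, HomogKernel (fun x => x μ * x ν * localFamily a b c μ ν x) A Λ :=
  exists_homogKernel_moment (isHomog_localFamily a b c μ ν) (contDiffOn_localFamily a b c μ ν) μ ν

/-- The transverse-structure moment kernel `x_μ x_ν T_{μν}(x)` is a `HomogKernel` for some constants. [folklore] -/
theorem exists_homogKernel_transverseMoment (μ ν : Fin 4) :
    ∃ A Λ : ℝ, HomogKernel (fun x => x μ * x ν * transverse μ ν x) A Λ :=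
  exists_homogKernel_moment (isHomog_transverse μ ν) (contDiffOn_transverse μ ν) μ ν

/-- **THE FIELD FORM**: for a tensor field `S` of degree `−6` whose `(μ,ν)` entry is `C¹` off the origin, the moment kernel
is a `HomogKernel` for some constants. [folklore] -/
theorem exists_homogKernel_fieldMoment {S : TensorField} (hH : IsHomogNegSix S) (hS : ContDiffOn ℝ 1 (fun x => S x μ ν) punct) :
    ∃ A Λ : ℝ, HomogKernel (fun x => x μ * x ν * S x μ ν) A Λ :=
  exists_homogKernel_moment (isHomog_entry_of_isHomogNegSix hH μ ν) hS μ ν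

/-- … hence `TransverseLink.fieldMomentKernel S μ ν` (the lattice restriction) satisfies `DyadicData` for some constant —
the `data` slot of `LargeLWindow.WindowDecomposition β0 (fieldMomentKernel S μ ν) …`. [folklore] -/
theorem exists_dyadicData_fieldMomentKernel {S : TensorField} (hH : IsHomogNegSix S)
    (hS : ContDiffOn ℝ 1 (fun x => S x μ ν) punct) : ∃ C : ℝ, DyadicData (fieldMomentKernel S μ ν) C := by
  obtain ⟨A, Λ, hK⟩ := exists_homogKernel_fieldMoment (μ := μ) (ν := ν) hH hS
  exact ⟨A + Λ, dyadicData_of_homogKernel hK⟩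

/-- **Covariant case, hypothesis-minimal**: `IsO4Covariant S ∧ IsHomogNegSix S` alone give the `DyadicData` of the field
moment kernel (smoothness of the entries is automatic). [folklore] -/
theorem exists_dyadicData_fieldMomentKernel_of_covariant {S : TensorField} (hS : IsO4Covariant S) (hH : IsHomogNegSix S)
    (μ ν : Fin 4) : ∃ C : ℝ, DyadicData (fieldMomentKernel S μ ν) C :=
  exists_dyadicData_fieldMomentKernel hH (contDiffOn_entry_of_covariant hS hH μ ν)

/-- The covariant-family lattice moment kernel (`TransverseLink.momentKernel`-type object written with `covFamily`) has
`DyadicData` for some constant. [folklore] -/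
theorem exists_dyadicData_covMoment (a b : ℝ) (μ ν : Fin 4) :
    ∃ C : ℝ, DyadicData (fun w : Pt => toReal w μ * toReal w ν * covFamily a b μ ν (toReal w)) C := by
  obtain ⟨A, Λ, hK⟩ := exists_homogKernel_covMoment a b μ ν
  exact ⟨A + Λ, dyadicData_of_homogKernel hK⟩

end

end Literature.MathematicalPhysics.QuantumFieldTheory.Balaban1983to89.Beta.HomogSmoothTransverse
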